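import Mathlib.Algebra.Group.Basic
import Mathlib.Data.Nat.GCD.Basic
import HarnessLib

/-!
# [IUTchI] Remark 3.2.4: the convention on "tempered-meromorphic" functions (errata to [EtTh] §3–4)

S. Mochizuki, *Inter-universal Teichmüller theory I*, §3, Remark 3.2.4 (i)–(vi) (kurims final
manuscript May 2020, pp. 75–77) [claim: Mochizuki2012, status: disputed]. The Remark corrects
"certain minor oversights" in the theory of tempered Frobenioids of [EtTh] §3, §4 and FIXES THE
CONVENTION used throughout [IUTchI–IV]; it is typed here as the printed logical structure over an
INTERFACE (the analytic inputs — the universal combinatorial covering `Z^log_∞` of a stable log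
curve, tempered coverings, log-divisors — are [EtTh] §3 material, owner abc-iut-L2-t3, TODO-merge).

(i) For a nonzero meromorphic function `f` on `Z^log_∞`, conditions
  (a) "for every `N ∈ ℕ_{≥1}`, `f` admits an `N`-th root over some tempered covering of `Z^log`";
  (b) the same for every `N` prime to `p`;
  (c) "the divisor of zeroes and poles of `f` is a log-divisor";
  "it is immediate that (a) implies (b)" (PROVED here, being formal); "(b) implies (c)" and, for
  such `f`, "(c) implies (b)" (typed as statements); "(a) ⟹ (b) ⟺ (c)"; "it is not clear … whether
  (c) [or (b)] implies (a)" (nothing typed).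
(ii) the theta function of [EtTh] satisfies (a) ([EtTh] Prop. 1.3) — a statement.
(iii) [EtTh] Def. 3.1 (ii) defined "log-meromorphic" by (c), but [EtTh] Prop. 4.2 (iii) needs (a).
(iv)/(v) two remedies (A): redefine "log-meromorphic" as (a) ("tempered-meromorphic"); (B): modify
  [EtTh] Def. 4.1 (i) by the Frobenioid-theoretic version (d) of (a); "in the present series of
  papers, we shall interpret the notion of a 'tempered Frobenioid' via the approach of (A)" — typed
  as the DEFINITION `IsTemperedMeromorphic := (a)`.
(vi) three textual modifications to [EtTh] Ex. 3.9 (recorded in this docstring only: "`Y^log` is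
  of genus `1` and has either precisely one cusp or precisely two cusps whose difference is a
  `2`-torsion element"; "`Ẋ^log → Ċ^log`"; "unramified over the cusps as well as over the generic
  points of the irreducible components of the special fibers"; "tempered admissible coverings").
-/

namespace Literature.IUT.HodgeTheaters

universe u

/-- INTERFACE for Rmk 3.2.4 (i): the nonzero meromorphic functions on `Z^log_∞` with the two
predicates the Remark quantifies over (TODO-merge:abc-iut-L2-t3 [EtTh] §3: `Z^log_∞`, tempered
coverings, log-divisors). [claim: Mochizuki2012, status: disputed] -/
structure MeromorphicRootSetting where
  /-- the multiplicative group of nonzero meromorphic functions on `Z^log_∞` -/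
  Mer : Type u
  /-- its group structure -/
  [instGroup : CommGroup Mer]
  /-- the residue characteristic `p` of the base MLF -/
  p : ℕ
  /-- "`f` admits an `N`-th root over some tempered covering of `Z^log`" -/
  AdmitsRootOverTempered : Mer → ℕ → Prop
  /-- "the divisor of zeroes and poles of `f` is a log-divisor" -/
  HasLogDivisor : Mer → Prop

attribute [instance] MeromorphicRootSetting.instGroup

namespace MeromorphicRootSetting

variable (Z : MeromorphicRootSetting.{u})

/-- Rmk 3.2.4 (i) (a): "For every `N ∈ ℕ_{≥1}`, it holds that `f` admits an `N`-th root over some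
tempered covering of `Z^log`." [claim: Mochizuki2012, status: disputed] -/
def CondA (f : Z.Mer) : Prop := ∀ N : ℕ, 1 ≤ N → Z.AdmitsRootOverTempered f N

/-- Rmk 3.2.4 (i) (b): "For every `N ∈ ℕ_{≥1}` which is prime to `p`, it holds that `f` admits an
`N`-th root over some tempered covering of `Z^log`." [claim: Mochizuki2012, status: disputed] -/
def CondB (f : Z.Mer) : Prop := ∀ N : ℕ, 1 ≤ N → N.Coprime Z.p → Z.AdmitsRootOverTempered f N

/-- Rmk 3.2.4 (i) (c): "The divisor of zeroes and poles of `f` is a log-divisor."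
[claim: Mochizuki2012, status: disputed] -/
def CondC (f : Z.Mer) : Prop := Z.HasLogDivisor f

/-- Rmk 3.2.4 (i): "It is immediate that (a) implies (b)" — PROVED (formal).
[claim: Mochizuki2012, status: disputed] -/
theorem condB_of_condA (f : Z.Mer) (h : Z.CondA f) : Z.CondB f :=
  fun N hN _ => h N hN

/-- Rmk 3.2.4 (i): "(b) implies (c)" ("by considering the ramification divisors of the tempered
coverings that arise from extracting roots of `f`") — typed as a statement about the setting.
[claim: Mochizuki2012, status: disputed] -/
def BImpliesC (Z : MeromorphicRootSetting.{u}) : Prop := ∀ f : Z.Mer, Z.CondB f → Z.CondC f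

/-- Rmk 3.2.4 (i): "(c) implies (b)" (via admissible coverings [PrfGC] §2, §8: a finite log étale
covering `Y^log → Z^log` satisfying (R1), (R2)) — typed as a statement about the setting.
[claim: Mochizuki2012, status: disputed] -/
def CImpliesB (Z : MeromorphicRootSetting.{u}) : Prop := ∀ f : Z.Mer, Z.CondC f → Z.CondB f

/-- Rmk 3.2.4 (i), summary display "(a) ⟹ (b) ⟺ (c)", as one statement about the setting (the
first arrow is `condB_of_condA`; "it is not clear … whether or not (c) [or (b)] implies (a)").
[claim: Mochizuki2012, status: disputed] -/
def SummaryImplications (Z : MeromorphicRootSetting.{u}) : Prop :=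
  (∀ f : Z.Mer, Z.CondA f → Z.CondB f) ∧ ∀ f : Z.Mer, Z.CondB f ↔ Z.CondC f

/-- The summary holds as soon as the two non-formal implications do — PROVED.
[claim: Mochizuki2012, status: disputed] -/
theorem summaryImplications_of (hBC : Z.BImpliesC) (hCB : Z.CImpliesB) : Z.SummaryImplications :=
  ⟨fun f => Z.condB_of_condA f, fun f => ⟨hBC f, hCB f⟩⟩

/-- Rmk 3.2.4 (ii): "the theta function that forms the main topic of interest of [EtTh] satisfies
condition (a)" ([EtTh] Prop. 1.3) — typed as a statement about a given element `θ`.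
[claim: Mochizuki2012, status: disputed] -/
def ThetaSatisfiesA (θ : Z.Mer) : Prop := Z.CondA θ

/-- Rmk 3.2.4 (iv) (A), (v): "One may modify [EtTh], Definition 3.1, (ii), by taking the definition
of a 'log-meromorphic' function to be a function that satisfies condition (a) … perhaps a better
term … would be 'tempered-meromorphic'"; "in the present series of papers, we shall interpret the
notion of a 'tempered Frobenioid' via the approach of (A)" — the CONVENTION, as a definition.
[claim: Mochizuki2012, status: disputed] -/
def IsTemperedMeromorphic (f : Z.Mer) : Prop := Z.CondA f

/-- Rmk 3.2.4 (iii): the original [EtTh] Def. 3.1 (ii) notion "log-meromorphic" = condition (c)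
(recorded for contrast; NOT the convention of [IUTchI–IV]). [claim: Mochizuki2012, status: disputed] -/
def IsLogMeromorphicEtTh (f : Z.Mer) : Prop := Z.CondC f

/-- Under approach (A) every tempered-meromorphic function is log-meromorphic in the original sense,
granted "(b) implies (c)" — PROVED from the statements. [claim: Mochizuki2012, status: disputed] -/
theorem isLogMeromorphicEtTh_of_isTemperedMeromorphic (hBC : Z.BImpliesC) (f : Z.Mer)
    (hf : Z.IsTemperedMeromorphic f) : Z.IsLogMeromorphicEtTh f :=
  hBC f (Z.condB_of_condA f hf)

/-- Rmk 3.2.4 (iv) (B), condition (d) (the "Frobenioid-theoretic version" of (a)): "For every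
`N ∈ ℕ_{≥1}`, there exists a linear morphism `A′ → A` in `C` such that the pull-back of `f` to `A′`
admits an `N`-th root" — typed over an abstract pull-back-and-root predicate (the Frobenioid `C` and
its linear morphisms are [FrdI]/[EtTh] §4 material). [claim: Mochizuki2012, status: disputed] -/
def CondD (PullbackAdmitsRoot : Z.Mer → ℕ → Prop) (f : Z.Mer) : Prop :=
  ∀ N : ℕ, 1 ≤ N → PullbackAdmitsRoot f N

end MeromorphicRootSetting

end Literature.IUT.HodgeTheaters
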